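/-
Copyright: cell pub-balaban-gaps (YM BLITZ Y1, track G1), seat g1-p2 GEN 11 (unit `pub-balaban-gaps-g1-p2`).  Row (D4) NODE O, OBJECT ∕
MECHANISM level: the DERIVATIVE LETTERS OF A LOCAL INVERSE from FORM DATA — ENTRY 2 of print's (3.42) for the inverses that the (L) step
produces: if `A` is conjugated-coercive `m` at rate `κ` along `ρ` and its conjugated gradients are dominated
(`Σ_μ‖conjMat ∇_μ z‖² ≤ γ·Re conjForm A z + c_D‖z‖²`, the `hA` ∕ `hD` of `D4WalkBlockFormCoercive`), then for `Ax = v` the WEIGHTED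
gradients of the solution are bounded by the weighted source, `Σ_μ‖e^{κρ}∇_μ x‖² ≤ (γ∕m + c_D∕m²)·‖e^{κρ}v‖²`, hence the Combes–Thomas
PAIRING DECAY of `∇_μA⁻¹` (`|⟨u, ∇_μA⁻¹v⟩| ≤ e^{−κR}√(γ∕m + c_D∕m²)·‖u‖‖v‖` across a gap `R` of the weight) and the ENTRYWISE decay
`|(∇_μA⁻¹)(i,j)| ≤ √(γ∕m + c_D∕m²)·e^{−κd(i,j)}` — the gradients enter through NO letter of their own (k-UNIFORM on a fine carrier when `m, γ, c_D`
are; g1-plan-1 GEN 38 V62 ∕ V84: «(3.89) O(M⁻¹) = ∂h_□ paired with ENTRY 2 of (3.42)»).  HONEST FRAMING: mechanism ([folklore], the T4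
substrate's weighted Combes–Thomas engine BY NAME); the form data are hypotheses; Bałaban's `Δ^{(k)}(𝐔)` NOT constructed; (D4) instance 0∕1;
NOT BetaPertH, NOT continuum, NOT Clay.
-/
import Summits.QuantumFields.BalabanUV.T4Continuum.Support.CTWeightedCoercivity

/-!
# `Gaps.D4WalkBlockFormGradientDecay` — weighted gradient bounds and Combes–Thomas decay of `∇_μA⁻¹` from conjugated coercivity and gradient
# domination (cell pub-balaban-gaps, seat g1-p2 gen 11)

HONEST DEPENDENCY (cell pub-balaban, verbatim): continuum YM on T⁴ ⇐ BetaPertH ∧ nine spine estimates (0/9 proved); BetaPertH ⇐ (D1) ∧ (D4) ∧ CAP+tail.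

[B9] (3.42) p. 399: the local Green functions `G_□` satisfy `|G_□(x,x′)|, |∇G_□(x,x′)|, … ≤ O(1)e^{−δ₀|x−x′|}` with scale-free constants; (3.89) p. 409:
the commutator terms `[Δ′, h_□]G′_□` are small because `∂h_□ = O(M⁻¹)` multiplies `∇G′_□` (entry 2).  ABSTRACTLY ([folklore] throughout):
* **`sum_nsq_wvec_grad_le`** — `Ax = v`, `WCoercive A κ ρ m` (`m > 0`), domination `(γ, c_D)` (`γ, c_D ≥ 0`):
  `Σ_μ ‖e^{κρ}·∇_μ x‖² ≤ (γ∕m + c_D∕m²)·‖e^{κρ}v‖²`;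
* **`grad_pairing_decay`** — `κ ≥ 0`, `u` supported in `{R ≤ ρ}`, `v` in `{ρ ≤ 0}`: `|⟨u, ∇_μ x⟩| ≤ e^{−κR}√(γ∕m + c_D∕m²)·‖u‖·‖v‖`;
  `grad_pairing_decay_inv` (the same for `x = A⁻¹v`);
* **`norm_grad_inv_apply_le`** — along the column weight `d(·, j)` with `d(j, j) = 0`: `|(∇_μ·A⁻¹)(i, j)| ≤ √(γ∕m + c_D∕m²)·e^{−κd(i,j)}`.
WHAT IT IS NOT.  Block (ℓ^∞) letters need a row count `Σ_j e^{−κd(i,j)}` (k-dependent on a fine carrier, g1-plan-1 (σ)); the instances (111 ∕ 112 ∕ 114's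
data for 59b–66's operator) plug in by name but are not restated here; (D4) instance 0∕1; words of row (D4) UNCHANGED (`ExistsUniformAcrossSmall 𝓣_Bałaban α
Rσ₀ θ₀` + `TermDomination`, OBJECT level).

References (method only): T. Bałaban, Comm. Math. Phys. **99** (1985) 389–434 [B9], (3.42) p. 399, Cor. 3.6 p. 408, (3.89) p. 409; J.-M. Combes,
L. Thomas, Comm. Math. Phys. **34** (1973) 251–270.
-/

noncomputable section

namespace Summit.QuantumFields.BalabanUV.Gaps.D4WalkBlockFormGradientDecay

open Finset Complex Matrix
open scoped BigOperators Matrix ComplexConjugate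
open Literature.MathematicalPhysics.QuantumFieldTheory.Balaban1983to89.B5Prop11Lower (nsq nsq_nonneg norm_star_dotProduct_le)
open Summit.QuantumFields.BalabanUV.Beta.AccretiveCombesThomas (conjForm)
open Summit.QuantumFields.BalabanUV.T4Continuum.ScalarCovariantCTWeighted (wvec dotProduct_wvec nsq_wvec_le_of_nonpos sqrt_nsq_wvec_neg_le)
open Summit.QuantumFields.BalabanUV.T4Continuum.CTWeightedCoercivity (conjMat wvec_mulVec WCoercive)

variable {ι : Type*} [Fintype ι] [DecidableEq ι] {μs : Type*} [Fintype μs]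
variable {A : Matrix ι ι ℂ} {D : μs → Matrix ι ι ℂ} {κ : ℝ} {ρ : ι → ℝ} {m γ cD : ℝ}

omit [DecidableEq ι] in
/-- **THE WEIGHTED GRADIENTS OF THE SOLUTION ARE BOUNDED BY THE WEIGHTED SOURCE**: for `Ax = v`, conjugated coercivity `m > 0` and gradient
domination `(γ, c_D)`: `Σ_μ ‖e^{κρ}∇_μ x‖² ≤ (γ∕m + c_D∕m²)·‖e^{κρ}v‖²`. [folklore] [cite: Balaban1985BackgroundPropagators, (3.42) p.399] -/
theorem sum_nsq_wvec_grad_le (h : WCoercive A κ ρ m) (hm : 0 < m) (hγ : 0 ≤ γ) (hcD : 0 ≤ cD)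
    (hD : ∀ z, ∑ μ, nsq (conjMat κ ρ ρ (D μ) *ᵥ z) ≤ γ * (conjForm A κ ρ z).re + cD * nsq z) {x v : ι → ℂ} (hx : A *ᵥ x = v) :
    ∑ μ, nsq (wvec κ ρ (D μ *ᵥ x)) ≤ (γ / m + cD / m ^ 2) * nsq (wvec κ ρ v) := by
  set z := wvec κ ρ x with hz
  set w := wvec κ ρ v with hw
  have hsol := h.solution_bound hx
  rw [← hz, ← hw] at hsol
  have hform : conjForm A κ ρ z = star z ⬝ᵥ w := WCoercive.conjForm_solution A κ ρ hx
  have hCS : (star z ⬝ᵥ w).re ≤ Real.sqrt (nsq z) * Real.sqrt (nsq w) := (Complex.re_le_norm _).trans (norm_star_dotProduct_le z w)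
  set Z := Real.sqrt (nsq z)
  set W := Real.sqrt (nsq w)
  have hZ0 : 0 ≤ Z := Real.sqrt_nonneg _
  have hW0 : 0 ≤ W := Real.sqrt_nonneg _
  have hZ2 : Z ^ 2 = nsq z := Real.sq_sqrt (nsq_nonneg _)
  have hW2 : W ^ 2 = nsq w := Real.sq_sqrt (nsq_nonneg _)
  have hZle : Z ≤ W / m := by rw [le_div_iff₀ hm, mul_comm]; exact hsol
  have hgrad : ∑ μ, nsq (wvec κ ρ (D μ *ᵥ x)) = ∑ μ, nsq (conjMat κ ρ ρ (D μ) *ᵥ z) :=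
    Finset.sum_congr rfl fun μ _ => by rw [wvec_mulVec κ ρ ρ (D μ) x]
  rw [hgrad]
  calc ∑ μ, nsq (conjMat κ ρ ρ (D μ) *ᵥ z) ≤ γ * (conjForm A κ ρ z).re + cD * nsq z := hD z
    _ ≤ γ * (Z * W) + cD * Z ^ 2 := by rw [hform, hZ2]; exact add_le_add (mul_le_mul_of_nonneg_left hCS hγ) le_rfl
    _ ≤ γ * (W / m * W) + cD * (W / m) ^ 2 := by gcongr
    _ = (γ / m + cD / m ^ 2) * W ^ 2 := by ring
    _ = (γ / m + cD / m ^ 2) * nsq w := by rw [hW2]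

omit [DecidableEq ι] in
/-- one gradient: `‖e^{κρ}∇_μ x‖ ≤ √(γ∕m + c_D∕m²)·‖e^{κρ}v‖`. -/
theorem sqrt_nsq_wvec_grad_le (h : WCoercive A κ ρ m) (hm : 0 < m) (hγ : 0 ≤ γ) (hcD : 0 ≤ cD)
    (hD : ∀ z, ∑ μ, nsq (conjMat κ ρ ρ (D μ) *ᵥ z) ≤ γ * (conjForm A κ ρ z).re + cD * nsq z) {x v : ι → ℂ} (hx : A *ᵥ x = v) (μ : μs) :
    Real.sqrt (nsq (wvec κ ρ (D μ *ᵥ x))) ≤ Real.sqrt (γ / m + cD / m ^ 2) * Real.sqrt (nsq (wvec κ ρ v)) := by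
  have h1 : nsq (wvec κ ρ (D μ *ᵥ x)) ≤ ∑ ν, nsq (wvec κ ρ (D ν *ᵥ x)) :=
    Finset.single_le_sum (f := fun ν => nsq (wvec κ ρ (D ν *ᵥ x))) (fun ν _ => nsq_nonneg _) (Finset.mem_univ μ)
  rw [← Real.sqrt_mul (by positivity)]
  exact Real.sqrt_le_sqrt (h1.trans (sum_nsq_wvec_grad_le h hm hγ hcD hD hx))

omit [DecidableEq ι] in
/-- **COMBES–THOMAS PAIRING DECAY OF THE GRADIENT OF THE SOLUTION**: `κ ≥ 0`, `u` supported in `{R ≤ ρ}`, `v` in `{ρ ≤ 0}`, `Ax = v` ⟹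
`|⟨u, ∇_μ x⟩| ≤ e^{−κR}·√(γ∕m + c_D∕m²)·‖u‖·‖v‖`. [folklore] [cite: Balaban1985BackgroundPropagators, (3.42) p.399, Cor. 3.6 p.408] -/
theorem grad_pairing_decay (h : WCoercive A κ ρ m) (hm : 0 < m) (hγ : 0 ≤ γ) (hcD : 0 ≤ cD) (hκ : 0 ≤ κ)
    (hD : ∀ z, ∑ μ, nsq (conjMat κ ρ ρ (D μ) *ᵥ z) ≤ γ * (conjForm A κ ρ z).re + cD * nsq z) {x v u : ι → ℂ} (hx : A *ᵥ x = v)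
    {R : ℝ} (hu : ∀ e, u e ≠ 0 → R ≤ ρ e) (hv : ∀ e, v e ≠ 0 → ρ e ≤ 0) (μ : μs) :
    ‖star u ⬝ᵥ (D μ *ᵥ x)‖ ≤ Real.exp (-(κ * R)) * Real.sqrt (γ / m + cD / m ^ 2) * (Real.sqrt (nsq u) * Real.sqrt (nsq v)) := by
  rw [dotProduct_wvec κ ρ u (D μ *ᵥ x)]
  have hU := sqrt_nsq_wvec_neg_le hκ hu
  have hG := sqrt_nsq_wvec_grad_le h hm hγ hcD hD hx μ
  have hV : Real.sqrt (nsq (wvec κ ρ v)) ≤ Real.sqrt (nsq v) := Real.sqrt_le_sqrt (nsq_wvec_le_of_nonpos hκ hv)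
  calc ‖star (wvec (-κ) ρ u) ⬝ᵥ wvec κ ρ (D μ *ᵥ x)‖ ≤ Real.sqrt (nsq (wvec (-κ) ρ u)) * Real.sqrt (nsq (wvec κ ρ (D μ *ᵥ x))) :=
        norm_star_dotProduct_le _ _
    _ ≤ (Real.exp (-(κ * R)) * Real.sqrt (nsq u)) * (Real.sqrt (γ / m + cD / m ^ 2) * Real.sqrt (nsq v)) :=
        mul_le_mul hU (hG.trans (mul_le_mul_of_nonneg_left hV (Real.sqrt_nonneg _))) (Real.sqrt_nonneg _) (by positivity)
    _ = Real.exp (-(κ * R)) * Real.sqrt (γ / m + cD / m ^ 2) * (Real.sqrt (nsq u) * Real.sqrt (nsq v)) := by ring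

/-- the same read on the inverse: `x = A⁻¹v`. -/
theorem grad_pairing_decay_inv (h : WCoercive A κ ρ m) (hm : 0 < m) (hγ : 0 ≤ γ) (hcD : 0 ≤ cD) (hκ : 0 ≤ κ)
    (hD : ∀ z, ∑ μ, nsq (conjMat κ ρ ρ (D μ) *ᵥ z) ≤ γ * (conjForm A κ ρ z).re + cD * nsq z) {v u : ι → ℂ}
    {R : ℝ} (hu : ∀ e, u e ≠ 0 → R ≤ ρ e) (hv : ∀ e, v e ≠ 0 → ρ e ≤ 0) (μ : μs) :
    ‖star u ⬝ᵥ ((D μ * A⁻¹) *ᵥ v)‖ ≤ Real.exp (-(κ * R)) * Real.sqrt (γ / m + cD / m ^ 2) * (Real.sqrt (nsq u) * Real.sqrt (nsq v)) := by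
  have hAx : A *ᵥ (A⁻¹ *ᵥ v) = v := by
    rw [Matrix.mulVec_mulVec, Matrix.mul_nonsing_inv A ((Matrix.isUnit_iff_isUnit_det A).mp (WCoercive.isUnit h hm)), Matrix.one_mulVec]
  rw [← Matrix.mulVec_mulVec]
  exact grad_pairing_decay h hm hγ hcD hκ hD hAx hu hv μ

/-- **ENTRYWISE DECAY OF `∇_μA⁻¹` ALONG A COLUMN WEIGHT**: with `ρ = d(·, j)`, `d(j, j) = 0`, `κ ≥ 0`:
`|(∇_μ·A⁻¹)(i, j)| ≤ √(γ∕m + c_D∕m²)·e^{−κd(i,j)}` — entry 2 of (3.42) for the inverse, from form data only. [cite: Balaban1985BackgroundPropagators, (3.42) p.399, Cor. 3.6 p.408] -/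
theorem norm_grad_inv_apply_le {d : ι → ι → ℝ} (j : ι) (hd0 : d j j = 0) (h : WCoercive A κ (fun e => d e j) m) (hm : 0 < m)
    (hγ : 0 ≤ γ) (hcD : 0 ≤ cD) (hκ : 0 ≤ κ)
    (hD : ∀ z, ∑ μ, nsq (conjMat κ (fun e => d e j) (fun e => d e j) (D μ) *ᵥ z) ≤ γ * (conjForm A κ (fun e => d e j) z).re + cD * nsq z)
    (μ : μs) (i : ι) : ‖(D μ * A⁻¹) i j‖ ≤ Real.sqrt (γ / m + cD / m ^ 2) * Real.exp (-(κ * d i j)) := by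
  have hu : ∀ e, (Pi.single i (1 : ℂ) : ι → ℂ) e ≠ 0 → d i j ≤ d e j := fun e he => by
    by_cases hei : e = i
    · rw [hei]
    · exact absurd (Pi.single_eq_of_ne hei _) he
  have hv : ∀ e, (Pi.single j (1 : ℂ) : ι → ℂ) e ≠ 0 → d e j ≤ 0 := fun e he => by
    by_cases hej : e = j
    · rw [hej, hd0]
    · exact absurd (Pi.single_eq_of_ne hej _) he
  have key := grad_pairing_decay_inv (u := Pi.single i 1) (v := Pi.single j 1) (R := d i j) h hm hγ hcD hκ hD hu hv μ
  have hentry : star (Pi.single i (1 : ℂ)) ⬝ᵥ ((D μ * A⁻¹) *ᵥ Pi.single j 1) = (D μ * A⁻¹) i j := by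
    rw [Matrix.mulVec_single_one, Pi.star_single, star_one, single_one_dotProduct]; rfl
  have hn1 : Real.sqrt (nsq (Pi.single i (1 : ℂ))) = 1 := by
    rw [nsq, Finset.sum_eq_single i (fun e _ he => by rw [Pi.single_eq_of_ne he, norm_zero, zero_pow two_ne_zero])
      (fun h => absurd (Finset.mem_univ i) h), Pi.single_eq_same, norm_one, one_pow, Real.sqrt_one]
  have hn2 : Real.sqrt (nsq (Pi.single j (1 : ℂ))) = 1 := by
    rw [nsq, Finset.sum_eq_single j (fun e _ he => by rw [Pi.single_eq_of_ne he, norm_zero, zero_pow two_ne_zero])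
      (fun h => absurd (Finset.mem_univ j) h), Pi.single_eq_same, norm_one, one_pow, Real.sqrt_one]
  rw [hentry, hn1, hn2, mul_one, mul_one] at key
  linarith

end Summit.QuantumFields.BalabanUV.Gaps.D4WalkBlockFormGradientDecay

end
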